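import Literature.MathematicalPhysics.QuantumFieldTheory.Balaban1983to89.Node00.N24Thm1Stage13RebindXWithB8PinB10YZW0SepCoPHG

/-!
# NODE N24 · THE `Y₀`-GENERIC [B9]-PIN EDITION OF THE FOUR-PIN STAGE-13 ENGINE: the ₁₃CCoPH record, the 𝐑-leaf reading, the G-class hosting and the ELEVEN nodes N01–N11 at a world bound to
# `(upOfRecord₅C (((((θ.rebindX X′).toStage5₁₃CoPH).pinB10).pinY Y₀).pinZ (Z11OfRecord ζ)).pinW W₀) P).withB8 (b8sel P)` with the [B9] bundle `Y₀ : PrintedCarriers9X` FREE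

TRACK A (YM-PLAN §2d, node N24 of 28 = binder B2), seat `pub-ymgap-dag-n24-c` (R134 s2; gen 14, INTENT-67).  Key K1⁹ = stmt-QuantumFields-27364 (`--kind proof --supports 27364`; count-neutral).
A NEW importing module; five TOKEN-SUBSTITUTION twins of this seat's landed engine lemmas (`N24NodesStage13FourPinPointedCoPH` §3 p?, `N24NodesStage13RebindXWithB8PinB10YZW0SepCoPHG` §0∕§3 p616199,
`N24Thm1Stage13RebindXWithB8PinB10YZW0SepCoPHG` §1, Part 36) under `(Mstar) (ops : OpsY N θ.toStage3Params Mstar) ↦ (Y₀ : PrintedCarriers9X)`, `Y9OfRecord N θ.toStage3Params Mstar ops ↦ Y₀`.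
THEOREMS ONLY, def-free, sorry-free, standard axioms.

WHY (dag-lead DEDUP-288 (1b), 2026-08-27: «n24 pens: knit files read the view by name — port when the re-pinned [B9] bundle lands»; node00-def-K0a FILE 19 `Node00/CarriersYP` = the `…P` image
`Y9OfRecordP` — the [B9] bundle over print's RE-SIZED class, «the one [B9] USES (pp. 404, 408–409) … the re-pin of the OBJECT OF RECORD»; dag-n06-d's certificate of record (ed. 52 p675453 and
successors) concludes `B9LeafX (Y9OfRecordP N θ.toStage3Params Mstar (opsYNuOfRecordV4PE …))`).  Every engine lemma of this lineage SPELLS the pin `pinY F N (Y9OfRecord N θ.toStage3Params Mstar ops)`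
(def-Y's literal p. 396 class) although every lemma it uses is VALUE-GENERIC in the bundle (`Stage13Params.pinY_admissible_iff`, `Provisos₁₃CoPH.pinY`, `datumOfRecord₁₃[Sep]CoPH_pinY`,
`Stage13HParams.toStage5₁₃CoPH_pinY`, `upOfRecord₅C_pinY_b9_iff`, all stated for `Y₀ : PrintedCarriers9X`); by `B9LeafXClassAntitone` the literal-class leaf implies the P-class leaf and NOT
conversely, so the K1 face (p650613 → … → p680188) does not read N06's road of record by name.  THIS MODULE frees the pin: `h06 : B9LeafX Y₀` for ANY bundle; the Summits-side K1 face then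
displays N06 at `Y9OfRecordP 2 (stage3OfFamily F) Mstar ops` (companion files INTENT-68–70).  Nothing else changes: N01–N04 by node00-def-T's record theorems, N05 ← `b8sel`, N07–N11 as before.

HONEST FRAMING: bookkeeping BY NAME (the originals' proof bytes with one token renamed); NO estimate; nothing of Bałaban's asserted; a FREE bundle `Y₀` is junk-inhabitable at this ENGINE
level exactly as `Y9OfRecord … ops` is over a junk operator layer (node00-def-Y's non-vacuity note) — the honest display of N06 lives in the FACE (`Y9OfRecordP` + N06's operator layer of
record), not here; N06 NOT discharged; N24 COMPOSITE — no count moved (typed 28∕28 · discharged 6∕27 · A 6∕28); one finite 𝕋⁴ programme at fixed ε, Bałaban AS PRINTED; R4 = the conditional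
finite-𝕋⁴ rung `BalabanLadder.UV` only — NOT continuum ∕ ℝ⁴ ∕ OS ∕ mass gap ∕ Clay.
-/

noncomputable section

open scoped Matrix.Norms.L2Operator

namespace Literature.MathematicalPhysics.QuantumFieldTheory.Balaban1983to89.Node00

open DagBinding T4Continuum T4DatumAssembly FlowStepRuns AveragingRT
open FlowStep (BetaLowerH BetaUpperH)
open B14NodeKnitRecord9 (b14_main_at_construction_rhoOfRecord9_along)

variable {F : T4Family} {N : ℕ} [NeZero N]

/-! ## §0. The ₁₃CCoPH record at a world bound to the four-pin view with a FREE [B9] bundle `Y₀`, its re-bound-parameter twin, and the 𝐑-leaf reading -/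

/-- **A WORLD BOUND TO THE FOUR-PIN STAGE-13 VIEW `((θ.toStage5₁₃CoPH).pinB10).pinY Y₀ …` OVER `(datumOfRecord₁₃CoPH θ hP).C` IS A ₁₃CCoPH RECORD AT THE SAME DATUM — FOR ANY [B9] BUNDLE
`Y₀ : PrintedCarriers9X`** (the `Y₀`-generic twin of `N24_isRecordOfRecord₁₃CCoPH_of_up_pinB10YZW₀`; dag-n10-d's `Provisos₁₃.pin*`, `pin*_admissible_iff`, `datumOfRecord₁₃CoPH_pin*` are value-generic).
[cite: Balaban1989LargeFieldII, Thm 1 + (0.1) pp.355–356; Balaban1985UV3, Thm 1 p.257; Balaban1985BackgroundPropagators, Thm 3.1 p.397; Balaban1985Variational, Thm 1 p.279; Balaban1989LargeFieldI, (0.2) p.176 (bookkeeping)] -/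
theorem N24_isRecordOfRecord₁₃CCoPH_of_up_pinB10Y₀ZW₀ (θ : Stage13HParams F N) (hP : θ.Provisos₁₃CoPH F N) (hθ : θ.Admissible F N)
    (Y₀ : PrintedCarriers9X) (ζ : ResidZ F N) (W₀ : B12.RunParams → PrintedCarriers15) (w : WorldP)
    (hC : w.C = (datumOfRecord₁₃CoPH F N θ hP).C) (hγ : 0 < w.γ ∧ w.γ ≤ θ.γ) (hL : w.L = (θ.L : ℝ))
    (hup : ∀ P, w.up P = upOfRecord₅C F N (((((θ.toStage5₁₃CoPH F N).pinB10 F N).pinY F N (Y₀)).pinZ F N (Z11OfRecord F N ζ)).pinW F N W₀) P) :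
    IsRecordOfRecord₁₃CCoPH F N (datumOfRecord₁₃CoPH F N θ hP) w := by
  refine ⟨(((θ.pinB10 F N).pinY F N (Y₀)).pinZ F N (Z11OfRecord F N ζ)).pinW F N W₀,
    ((hP.pinB10.pinY (Y₀)).pinZ (Z11OfRecord F N ζ)).pinW W₀,
    (Stage13Params.pinW_admissible_iff F N _ _).2 ((Stage13Params.pinZ_admissible_iff F N _ _).2
      ((Stage13Params.pinY_admissible_iff F N _ _).2 ((Stage13Params.pinB10_admissible_iff F N θ.toStage13Params).2 hθ))), ?_, hC, hγ, hL, fun P => ?_⟩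
  · exact ((datumOfRecord₁₃CoPH_pinB10 F N θ hP).symm.trans
      ((datumOfRecord₁₃CoPH_pinY F N (θ.pinB10 F N) hP.pinB10 (Y₀)).symm.trans
        ((datumOfRecord₁₃CoPH_pinZ F N _ (hP.pinB10.pinY (Y₀)) (Z11OfRecord F N ζ)).symm.trans
          (datumOfRecord₁₃CoPH_pinW F N _ ((hP.pinB10.pinY (Y₀)).pinZ (Z11OfRecord F N ζ))
            W₀).symm)))
  · rw [hup P, Stage13HParams.toStage5₁₃CoPH_pinW, Stage13HParams.toStage5₁₃CoPH_pinZ, Stage13HParams.toStage5₁₃CoPH_pinY, Stage13HParams.toStage5₁₃CoPH_pinB10]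

/-- **THE C-BOUND TWIN WORLD OF THE GENERIC CHAIN OVER `θ.rebindX X′` WITH A FREE [B9] BUNDLE `Y₀` IS A ₁₃CCoPH RECORD AT θ's DATUM** (the `Y₀`-generic twin of
`N24_isRecordOfRecord₁₃CCoPH_twin_of_up_withB8_rebindX_pinB10YZW₀`; datum read back by dag-n10-d's `datumOfRecord₁₃CoPH_rebindX`).
[cite: Balaban1989LargeFieldII, Thm 1 + (0.1) pp.355–356; Balaban1988Convergent, p.244; Balaban1985BackgroundPropagators, Thm 3.1 p.397 (bookkeeping)] -/
theorem N24_isRecordOfRecord₁₃CCoPH_twin_of_up_withB8_rebindX_pinB10Y₀ZW₀ (θ : Stage13HParams F N) (hP : θ.Provisos₁₃CoPH F N) (hθ : θ.Admissible F N)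
    (X' : B12.RunParams → PrintedCarriersR) (Y₀ : PrintedCarriers9X) (ζ : ResidZ F N) (W₀ : B12.RunParams → PrintedCarriers15) (w : WorldP)
    (hC : w.C = (datumOfRecord₁₃CoPH F N θ hP).C) (hγ : 0 < w.γ ∧ w.γ ≤ θ.γ) (hL : w.L = (θ.L : ℝ)) :
    IsRecordOfRecord₁₃CCoPH F N (datumOfRecord₁₃CoPH F N θ hP)
      { w with up := fun P => upOfRecord₅C F N ((((((θ.rebindX F N X').toStage5₁₃CoPH F N).pinB10 F N).pinY F N (Y₀)).pinZ F N (Z11OfRecord F N ζ)).pinW F N W₀) P } := by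
  have hX : (θ.rebindX F N X').Provisos₁₃CoPH F N := hP.rebindX X'
  have hD : datumOfRecord₁₃CoPH F N (θ.rebindX F N X') hX = datumOfRecord₁₃CoPH F N θ hP := datumOfRecord₁₃CoPH_rebindX F N θ hP X' hX
  rw [← hD]
  exact N24_isRecordOfRecord₁₃CCoPH_of_up_pinB10Y₀ZW₀ (θ.rebindX F N X') hX ((Stage13HParams.rebindX_admissible_iff F N θ X').2 hθ)
    Y₀ ζ W₀ _ (hC.trans (congrArg FiniteEpsData.C hD.symm)) hγ hL (fun _ => rfl)

/-- **The pins (any [B9] bundle `Y₀`) and a `withB8` re-binding never touch the 𝐑-carrier**: `(leavesP w P).rOperation ↔ ∀ k < K, TLaw₁₃CoPH θ P k → SLaw₁₃CoPH θ P (k+1)` (`Iff.rfl` to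
`ROpLeaf (VOfRecord₁₃CoPH (θ.rebindX X′) P)`, node00-def-T's `rOpLeaf_VOfRecord₁₃CoPH_iff`). [cite: Balaban1988Convergent, p.244 and Thm 2 p.263; Balaban1989LargeFieldII, Thm 1 p.355 (bookkeeping)] -/
theorem N24_rOperation_iff_of_up_withB8_rebindX_pinB10Y₀ZW₀_coPH (θ : Stage13HParams F N) (X' : B12.RunParams → PrintedCarriersR) (Y₀ : PrintedCarriers9X)
    (ζ : ResidZ F N) (W₀ : B12.RunParams → PrintedCarriers15) {b : Prop} {w : WorldP} {P : B12.RunParams}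
    (hup : w.up P = (upOfRecord₅C F N ((((((θ.rebindX F N X').toStage5₁₃CoPH F N).pinB10 F N).pinY F N (Y₀)).pinZ F N (Z11OfRecord F N ζ)).pinW F N W₀) P).withB8 b) :
    (leavesP w P).rOperation ↔ ∀ k, k < P.K → TLaw₁₃CoPH F N θ P k → SLaw₁₃CoPH F N θ P (k + 1) := by
  have hV : (leavesP w P).rOperation ↔ ROpLeaf (VOfRecord₁₃CoPH F N (θ.rebindX F N X') P) := by
    show (w.up P).rOperation ↔ _
    rw [hup]
    exact Iff.rfl
  exact hV.trans (rOpLeaf_VOfRecord₁₃CoPH_iff F N (θ.rebindX F N X') P)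

/-! ## §1. The G-class hosting and the ELEVEN nodes N01–N11 + the 𝐑-operation leaf at such a world (N06 ← `h06 : B9LeafX Y₀`) -/

/-- **★ G-CLASS HOSTING AT THE GENERIC CHAIN WITH A FREE [B9] BUNDLE `Y₀`** (`X′`, `Y₀`, `W₀`, `b8sel` FREE): a world with `w.C = (datumOfRecord₁₃SepCoPH θ h).C`, `0 < w.γ ≤ θ.γ`,
`w.L = θ.L`, `w.up P = (upOfRecord₅C (((((θ.rebindX X′).toStage5₁₃CoPH).pinB10).pinY Y₀).pinZ (Z11OfRecord ζ)).pinW W₀) P).withB8 (b8sel P)` IS in `IsRecordOfRecord₁₃CSepCoPHG` AT θ's DATUM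
(the `Y₀`-generic twin of `N24_recordG₁₃SepCoPH_of_up_withB8_rebindX_pinB10YZW₀`; dag-n05-w4's hosting p607735). [cite: Balaban1989LargeFieldII, Thm 1 + (0.1) pp.355–356; Balaban1988Convergent, p.244 and Thm 2 p.263; Balaban1985UV3, Thm 1 p.257; Balaban1985BackgroundPropagators, Thm 3.1 p.397; Balaban1985Variational, Thm 1 p.279; Balaban1989LargeFieldI, (0.2) p.176; Balaban1985RegularSpaces, Thm 8 (1.146) p.101 (bookkeeping)] -/
theorem N24_recordG₁₃SepCoPH_of_up_withB8_rebindX_pinB10Y₀ZW₀ (θ : Stage13HParams F N) (hP : θ.Provisos₁₃SepCoPH F N) (hθ : θ.Admissible F N)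
    (X' : B12.RunParams → PrintedCarriersR) (Y₀ : PrintedCarriers9X) (ζ : ResidZ F N) (W₀ : B12.RunParams → PrintedCarriers15)
    (b8sel : B12.RunParams → Prop) (w : WorldP)
    (hC : w.C = (datumOfRecord₁₃SepCoPH F N θ hP).C) (hγ : 0 < w.γ ∧ w.γ ≤ θ.γ) (hL : w.L = (θ.L : ℝ))
    (hup : ∀ P, w.up P = (upOfRecord₅C F N ((((((θ.rebindX F N X').toStage5₁₃CoPH F N).pinB10 F N).pinY F N (Y₀)).pinZ F N (Z11OfRecord F N ζ)).pinW F N W₀) P).withB8 (b8sel P)) :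
    IsRecordOfRecord₁₃CSepCoPHG F N (datumOfRecord₁₃SepCoPH F N θ hP) w := by
  have hX : (θ.rebindX F N X').Provisos₁₃SepCoPH F N := hP.rebindX X'
  have hD := datumOfRecord₁₃SepCoPH_rebindX F N θ hP X' hX
  rw [← hD] at hC ⊢
  have hθ' : (θ.rebindX F N X').Admissible F N := (Stage13HParams.rebindX_admissible_iff F N θ X').2 hθ
  have hA1 : ((θ.rebindX F N X').pinB10 F N).Admissible F N := (Stage13Params.pinB10_admissible_iff F N (θ.rebindX F N X').toStage13Params).2 hθ'
  have hA2 : (((θ.rebindX F N X').pinB10 F N).pinY F N (Y₀)).Admissible F N :=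
    (Stage13Params.pinY_admissible_iff F N ((θ.rebindX F N X').pinB10 F N).toStage13Params (Y₀)).2 hA1
  have hA3 : ((((θ.rebindX F N X').pinB10 F N).pinY F N (Y₀)).pinZ F N (Z11OfRecord F N ζ)).Admissible F N :=
    (Stage13Params.pinZ_admissible_iff F N (((θ.rebindX F N X').pinB10 F N).pinY F N (Y₀)).toStage13Params (Z11OfRecord F N ζ)).2 hA2
  have hA4 : (((((θ.rebindX F N X').pinB10 F N).pinY F N (Y₀)).pinZ F N (Z11OfRecord F N ζ)).pinW F N W₀).Admissible F N :=
    (Stage13Params.pinW_admissible_iff F N ((((θ.rebindX F N X').pinB10 F N).pinY F N (Y₀)).pinZ F N (Z11OfRecord F N ζ)).toStage13Params W₀).2 hA3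
  refine ⟨((((θ.rebindX F N X').pinB10 F N).pinY F N (Y₀)).pinZ F N (Z11OfRecord F N ζ)).pinW F N W₀,
    ((hX.pinB10.pinY (Y₀)).pinZ (Z11OfRecord F N ζ)).pinW W₀, b8sel, hA4, ?_, hC, hγ, hL, fun P => ?_⟩
  · exact ((datumOfRecord₁₃SepCoPH_pinB10 F N (θ.rebindX F N X') hX).symm.trans
      ((datumOfRecord₁₃SepCoPH_pinY F N ((θ.rebindX F N X').pinB10 F N) hX.pinB10 (Y₀)).symm.trans
        ((datumOfRecord₁₃SepCoPH_pinZ F N _ (hX.pinB10.pinY (Y₀)) (Z11OfRecord F N ζ)).symm.trans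
          (datumOfRecord₁₃SepCoPH_pinW F N _ ((hX.pinB10.pinY (Y₀)).pinZ (Z11OfRecord F N ζ)) W₀).symm)))
  · rw [hup P, Stage13HParams.toStage5₁₃CoPH_pinW, Stage13HParams.toStage5₁₃CoPH_pinZ, Stage13HParams.toStage5₁₃CoPH_pinY, Stage13HParams.toStage5₁₃CoPH_pinB10]

/-- **★ N24 · THE ELEVEN NODES N01–N11 AND THE 𝐑-OPERATION LEAF AT A WORLD BOUND TO THE GENERIC FOUR-PIN CHAIN WITH A FREE [B9] BUNDLE `Y₀`** (`X′`, `Y₀`, `W₀`, `b8sel` FREE;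
`W₀` UNREAD): N05 ← `h05G`; **N06 ← `h06 : B9LeafX Y₀`** (ANY bundle: def-Y's `Y9OfRecord … ops`, K0a's `Y9OfRecordP … ops`, …); N07 ∕ N08 leaves; N09 own leaf + Theorem-3 member `h09T`; N10 socket
(antecedent `B9LeafX Y₀`); N11 (S1ᵀ) `h11`; the 𝐑-reading `hR` ⇒ the eleven nodes `Dag.B4_main … Dag.B14_main` and `(leavesP w P).rOperation` at every run.  The `Y₀`-generic twin of
`N24_nodes11_rOperation₁₃CoPH_rebindX_withB8_pinB10YZW₀_pointed` (its proof bytes; `upOfRecord₅C_pinY_b9_iff` is value-generic). [cite: Balaban1989LargeFieldII, Thm 1 p.355, (0.1) pp.355–356, p.387, p.391; Balaban1985RegularSpaces, Lemma 1 – Thm 8 pp.79–101, Thm 8 (1.146) p.101; Balaban1985BackgroundPropagators, Thms 3.1–3.15 pp.397–432; Balaban1985Variational, Thm 1 p.279, Props 2–9 pp.281–309; Balaban1985UV3, Thm 1 p.257, Thm 2 p.272; Balaban1987RG1, Lemma 4 p.280, Thm 3 p.264; Balaban1988RG2Cluster, Lemmas 1–3 pp.9–20; Balaban1988Convergent, Thm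 1 p.262, Thm 2 p.263, p.244 (bookkeeping over the cell's DAG)] -/
theorem N24_nodes11_rOperation₁₃CoPH_rebindX_withB8_pinB10Y₀ZW₀_pointed (θ : Stage13HParams F N) (hP : θ.Provisos₁₃CoPH F N) (hθ : θ.Admissible F N)
    (X' : B12.RunParams → PrintedCarriersR) (Y₀ : PrintedCarriers9X) (ζ : ResidZ F N)
    (W₀ : B12.RunParams → PrintedCarriers15) (b8sel : B12.RunParams → Prop) (w : WorldP)
    (hC : w.C = (datumOfRecord₁₃CoPH F N θ hP).C) (hγ : 0 < w.γ ∧ w.γ ≤ θ.γ) (hL : w.L = (θ.L : ℝ))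
    (hup : ∀ P, w.up P = (upOfRecord₅C F N ((((((θ.rebindX F N X').toStage5₁₃CoPH F N).pinB10 F N).pinY F N (Y₀)).pinZ F N (Z11OfRecord F N ζ)).pinW F N W₀) P).withB8 (b8sel P))
    (h05G : ∀ P : B12.RunParams, b8sel P)
    (h06 : B9LeafX (Y₀))
    (h07 : B11Leaf (Z11OfRecord F N ζ))
    (h08 : PrintedUV3V N θ.L)
    (h09 : ∀ P : B12.RunParams, B12Sec2to5.Lemma4Printed (X' P).F12 (X' P).c12)
    (h09T : ∀ P : B12.RunParams, (leavesP w P).smallCouplings → (leavesP w P).smallFieldInductive)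
    (h10 : ∀ P : B12.RunParams, B9LeafX (Y₀) →
      (B10.Thm1PrintedCompact (((((((θ.rebindX F N X').toStage5₁₃CoPH F N).pinB10 F N).pinY F N (Y₀)).pinZ F N (Z11OfRecord F N ζ)).pinW F N W₀).res.X P).runs10 ∧
          B10.Thm2Printed (((((((θ.rebindX F N X').toStage5₁₃CoPH F N).pinB10 F N).pinY F N (Y₀)).pinZ F N (Z11OfRecord F N ζ)).pinW F N W₀).res.X P).runs10) →
        B11Leaf (Z11OfRecord F N ζ) → B12Sec2to5.Lemma4Printed (X' P).F12 (X' P).c12 →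
          B13.Lemma1Printed (X' P).S13 (X' P).c13 ∧ B13.Lemma2Printed (X' P).S13 (X' P).c13 ∧
            B13.Lemma3Printed (X' P).S13 (X' P).c13)
    (h11 : ∀ P : B12.RunParams, (leavesP w P).b7 → (leavesP w P).b8 → (leavesP w P).b9 → (leavesP w P).b10 → (leavesP w P).b11 →
      (leavesP w P).smallCouplings → (leavesP w P).smallFieldInductive → (leavesP w P).flowControl →
        ∀ k, k < P.K → SLaw₁₃CoPH F N θ P k → TLaw₁₃CoPH F N θ P k)
    (hR : ∀ (P : B12.RunParams) (k : ℕ), k < P.K → TLaw₁₃CoPH F N θ P k → SLaw₁₃CoPH F N θ P (k + 1)) :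
    ∀ P : B12.RunParams, (Dag.B4_main (leavesP w P) ∧ Dag.B5_main (leavesP w P) ∧ Dag.B6_main (leavesP w P) ∧ Dag.B7_main (leavesP w P) ∧
      Dag.B8_main (leavesP w P) ∧ Dag.B9_main (leavesP w P) ∧ Dag.B10_main (leavesP w P) ∧ Dag.B11_main (leavesP w P) ∧
      Dag.B12_main (leavesP w P) ∧ Dag.B13_main (leavesP w P) ∧ Dag.B14_main (leavesP w P)) ∧ (leavesP w P).rOperation := by
  intro P
  have hrec' := N24_isRecordOfRecord₁₃CCoPH_twin_of_up_withB8_rebindX_pinB10Y₀ZW₀ θ hP hθ X' Y₀ ζ W₀ w hC hγ hL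
  have hleaves := leavesP_eq_of_up_withB8 hup P
  have h4 : Dag.B4_main (leavesP w P) := by rw [hleaves]; exact b4_main_of_isRecordOfRecord₁₃CCoPH hrec' P
  have h5 : Dag.B5_main (leavesP w P) := by rw [hleaves]; exact b5_main_of_isRecordOfRecord₁₃CCoPH hrec' P
  have h6 : Dag.B6_main (leavesP w P) := by rw [hleaves]; exact N24_b6_main_of_isRecordOfRecord₁₃CCoPH hrec' P
  have h7 : Dag.B7_main (leavesP w P) := by rw [hleaves]; exact b7_main_of_isRecordOfRecord₁₃CCoPH hrec' P
  have hw := upOfRecord₅C_pinW_b9_b10_b11 F N (((((θ.rebindX F N X').toStage5₁₃CoPH F N).pinB10 F N).pinY F N (Y₀)).pinZ F N (Z11OfRecord F N ζ)) W₀ P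
  have hl : ((upOfRecord₅C F N ((((((θ.rebindX F N X').toStage5₁₃CoPH F N).pinB10 F N).pinY F N (Y₀)).pinZ F N (Z11OfRecord F N ζ)).pinW F N W₀) P).rBasicStep ↔ B15Leaf (W₀ P)) ∧
      ((upOfRecord₅C F N ((((((θ.rebindX F N X').toStage5₁₃CoPH F N).pinB10 F N).pinY F N (Y₀)).pinZ F N (Z11OfRecord F N ζ)).pinW F N W₀) P).b9 ↔ B9LeafX (Y₀)) ∧
      ((upOfRecord₅C F N ((((((θ.rebindX F N X').toStage5₁₃CoPH F N).pinB10 F N).pinY F N (Y₀)).pinZ F N (Z11OfRecord F N ζ)).pinW F N W₀) P).b10 ↔ PrintedUV3V N θ.L) ∧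
      ((upOfRecord₅C F N ((((((θ.rebindX F N X').toStage5₁₃CoPH F N).pinB10 F N).pinY F N (Y₀)).pinZ F N (Z11OfRecord F N ζ)).pinW F N W₀) P).b11 ↔ B11Leaf (Z11OfRecord F N ζ)) := by
    refine ⟨upOfRecord₅C_pinW_rBasicStep_iff F N _ _ P, ?_, ?_, ?_⟩
    · rw [hw.1, upOfRecord₅C_pinZ_b9]
      exact upOfRecord₅C_pinY_b9_iff F N _ _ P
    · rw [hw.2.1, upOfRecord₅C_pinZ_b10, upOfRecord₅C_pinY_b10]
      exact upOfRecord₅C_pinB10_b10_iff F N ((θ.rebindX F N X').toStage5₁₃CoPH F N) P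
    · rw [hw.2.2]
      exact upOfRecord₅C_pinZ_b11_iff F N _ _ P
  have h8 : (w.up P).b8 := by rw [hup P]; exact h05G P
  have h9 : (w.up P).b9 := by rw [hup P]; exact hl.2.1.2 h06
  have h10leaf : (w.up P).b10 := by rw [hup P]; exact hl.2.2.1.2 h08
  have h11leaf : (w.up P).b11 := by rw [hup P]; exact hl.2.2.2.2 h07
  have h12leaf : (leavesP w P).b12 := by
    show (w.up P).b12
    rw [hup P]; exact h09 P
  have h13 : Dag.B13_main (leavesP w P) := by
    have h' : Dag.B13_main (leavesP { w with up := fun P => upOfRecord₅C F N ((((((θ.rebindX F N X').toStage5₁₃CoPH F N).pinB10 F N).pinY F N (Y₀)).pinZ F N (Z11OfRecord F N ζ)).pinW F N W₀) P } P) :=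
      B13NodeKnitRecord5C.b13_main_at_stage5ParamsC F N ((((((θ.rebindX F N X').toStage5₁₃CoPH F N).pinB10 F N).pinY F N (Y₀)).pinZ F N (Z11OfRecord F N ζ)).pinW F N W₀) _ P rfl (h10 P)
    show (w.up P).b9 → (w.up P).b10 → (w.up P).b11 → (w.up P).b12 → (w.up P).b13
    rw [hup P]
    exact h'
  have hrop := N24_rOperation_iff_of_up_withB8_rebindX_pinB10Y₀ZW₀_coPH θ X' Y₀ ζ W₀ (hup P)
  exact ⟨⟨h4, h5, h6, h7, B8LeafKnit.b8_main_of_leaf w P h8, fun _ _ _ _ => h9, fun _ _ _ _ _ _ => h10leaf,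
    fun _ _ _ _ _ => h11leaf, B12NodeKnitRecord8.b12_main_of_leaf_of_thm3Member h12leaf (h09T P), h13,
    b14_main_at_construction_rhoOfRecord9_along F N (coreOfRecord₁₃CoPH F N θ) w P θ.ν θ.τ9 (EOfRecord₁₃ F N θ.toStage13Params) (wOfRecord₉ F N θ.toStage9Params) θ.ppSel
      (gOfRecord₁₃ F N θ.toStage13Params) (fun p k _ => SLaw₁₃CoPH F N θ p k) (fun p k _ => TLaw₁₃CoPH F N θ p k) (hC.trans (datumOfRecord₁₃CoPH_C F N θ hP))
      (fun _ _ => Iff.rfl) (fun _ => sLaw₁₃CoPH_zero F N θ P) (h11 P) (fun hr => hrop.1 hr)⟩, hrop.2 (hR P)⟩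

end Literature.MathematicalPhysics.QuantumFieldTheory.Balaban1983to89.Node00

end
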